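/-
Copyright (c) 2026. Released under Apache 2.0 license.

# CDT (4.3.3): the Eisenstein witness pins down the first row of its stabiliser

Interface for the degree lower bound `[M_N : M_2] ≥ c N³` (hypothesis `hdeg` of
`CalegariDimitrovTang2025_unboundedDenominators.of_printed_inputs'''`): an explicit element
`u = G₁₂^{(1,0)}/Δ ∈ M_N` whose stabiliser in `SL₂(ℤ)` under the weight-`0` action has first row
`≡ ±(1, 0) (mod N)`.  [CalegariDimitrovTang2025, §4.2 and (4.3.3); DiamondShurman2005, Thm. 4.2.3]
-/
import Literature.NumberTheory.Automorphic.UnboundedDenominatorsEisensteinWitness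
import HarnessLib

open Complex Real Filter Topology Function Metric Set
open UpperHalfPlane hiding I
open scoped Real Topology Manifold MatrixGroups ModularForm

namespace Literature.NumberTheory.Automorphic

namespace UnboundedDenominators

open _root_.Complex ModularGroup CongruenceSubgroup Matrix Matrix.SpecialLinearGroup
  Literature.NumberTheory.ModularForms EisensteinSeries

/-! ### The first row of `(1,0)·γ` -/

/-- `(1, 0)·γ = (γ₀₀, γ₀₁) (mod N)`. [folklore] -/
private theorem vecMul_one_zero_apply {N : ℕ} (γ : SL(2, ℤ)) (j : Fin 2) :
    ((![(1 : ZMod N), 0]) ᵥ* γ) j = ((γ 0 j : ℤ) : ZMod N) := by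
  fin_cases j <;> simp [Matrix.vecMul, dotProduct, Fin.sum_univ_two]


/-! ### The witness and its stabiliser -/

/-- **The Eisenstein witness for (4.3.3).**  For `N ≥ 3` there is `u ∈ M_N` — namely
`u = G₁₂^{(1,0)}/Δ` with `G₁₂^{(1,0)}` the (normalised, integral) Eisenstein series over the class
`(1, 0) + Nℤ²` — such that every `γ ∈ SL₂(ℤ)` fixing `u` under the weight-`0` action has first row
`(γ₀₀, γ₀₁) ≡ ±(1, 0) (mod N)`: indeed `γ • u = u` gives `G ∣₁₂ γ = G`, i.e. `G^{(1,0)γ} = G^{(1,0)}`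
(`latticeEisensteinMF_slash`), and the coefficient of `q_N` decides the class
(`latticeEisenstein_eq_one_zero_imp`). [cite: CalegariDimitrovTang2025, §4.2 and (4.3.3)] -/
theorem exists_levelField_witness_row (N : ℕ) [NeZero N] (hN : 3 ≤ N) :
    ∃ u ∈ levelField N, ∀ γ : SL(2, ℤ), γ • u = u →
      (((γ 0 0 : ℤ) : ZMod N) = 1 ∧ ((γ 0 1 : ℤ) : ZMod N) = 0) ∨
      (((γ 0 0 : ℤ) : ZMod N) = -1 ∧ ((γ 0 1 : ℤ) : ZMod N) = 0) := by
  classical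
  have h1 : (1 : ZMod N) ≠ 0 := by
    haveI : Fact (1 < N) := ⟨by omega⟩
    exact one_ne_zero
  obtain ⟨F, hFcoe, -, -, hmem⟩ :=
    exists_latticeEisenstein_mem_levelGens N (m := 1) one_pos h1
  refine ⟨algebraMap hol Mer (modFun 1 F), IntermediateField.subset_adjoin ℂ _ hmem,
    fun γ hγ ↦ ?_⟩
  -- `γ` fixes `F/Δ` in `hol`, hence `F ∣₁₂ γ = F`
  have hγ' : γ • modFun 1 F = modFun 1 F := by
    apply algebraMap_hol_injective
    rw [← smul_algebraMap]
    exact hγ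
  have hslash : (⇑F : ℍ → ℂ) ∣[12 * ((1 : ℕ) : ℤ)] γ = ⇑F :=
    slash_eq_of_forall_smul_modFun_eq F (Γ' := MulAction.stabilizer SL(2, ℤ) (modFun 1 F))
      (fun δ hδ ↦ hδ) hγ'
  -- transfer to the Eisenstein series: `G^{(1,0)γ} = G^{(1,0)}`
  set c : ℂ := (N : ℂ) ^ (12 * 1) * ((12 * 1 - 1).factorial : ℂ) / (-2 * π * Complex.I) ^ (12 * 1)
    with hc
  have hc0 : c ≠ 0 := by
    have h1' : (N : ℂ) ^ (12 * 1) ≠ 0 := pow_ne_zero _ (by exact_mod_cast NeZero.ne N)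
    have h2 : (-2 * π * Complex.I) ^ (12 * 1) ≠ 0 := by
      apply pow_ne_zero; simp [Real.pi_ne_zero, Complex.I_ne_zero]
    have h3 : ((12 * 1 - 1).factorial : ℂ) ≠ 0 := by exact_mod_cast Nat.factorial_ne_zero _
    rw [hc]
    exact div_ne_zero (mul_ne_zero h1' h3) h2
  have hk : (3 : ℤ) ≤ 12 * ((1 : ℕ) : ℤ) := by norm_num
  have hL : latticeEisenstein N (12 * ((1 : ℕ) : ℤ)) (![(1 : ZMod N), 0] ᵥ* γ) =
      latticeEisenstein N (12 * ((1 : ℕ) : ℤ)) ![1, 0] := by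
    have e1 := latticeEisenstein_slash (N := N) (k := 12 * ((1 : ℕ) : ℤ)) (a := ![(1 : ZMod N), 0]) γ
    have e2 : (⇑F : ℍ → ℂ) ∣[12 * ((1 : ℕ) : ℤ)] γ =
        c • (latticeEisenstein N (12 * ((1 : ℕ) : ℤ)) ![1, 0] ∣[12 * ((1 : ℕ) : ℤ)] γ) := by
      rw [hFcoe, ModularForm.SL_smul_slash]
    rw [hslash, e1, hFcoe] at e2
    exact (smul_right_injective (ℍ → ℂ) hc0 e2).symm
  -- normalise the weight to `((12 : ℕ) : ℤ)` and apply the coefficient criterion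
  have ek : (12 * ((1 : ℕ) : ℤ)) = ((12 : ℕ) : ℤ) := by norm_num
  rw [ek] at hL
  have hb := latticeEisenstein_eq_one_zero_imp (N := N) hN (k := 12) (by norm_num) ⟨6, rfl⟩
    (b := ![(1 : ZMod N), 0] ᵥ* γ) (by rw [coe_latticeEisensteinMF, coe_latticeEisensteinMF]; exact hL)
  have h00 := vecMul_one_zero_apply (N := N) γ 0
  have h01 := vecMul_one_zero_apply (N := N) γ 1
  rcases hb with hb | hb
  · left
    rw [hb] at h00 h01
    exact ⟨by simpa using h00.symm, by simpa using h01.symm⟩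
  · right
    rw [hb] at h00 h01
    exact ⟨by simpa using h00.symm, by simpa using h01.symm⟩

/-- The witness in the shape consumed by the assembly of `hdeg` (diagonal-mod-`N` stabilisers):
for `N ≥ 3` some `u ∈ M_N` is fixed, among the `γ ∈ SL₂(ℤ)` with `γ₁₀ ≡ γ₀₁ ≡ 0 (N)`, only by
those with `γ₀₀ ≡ ±1 (N)`. [cite: CalegariDimitrovTang2025, (4.3.3)] -/
theorem exists_levelField_witness_diag (N : ℕ) [NeZero N] (hN : 3 ≤ N) :
    ∃ u ∈ levelField N, ∀ γ : SL(2, ℤ), ((γ 1 0 : ℤ) : ZMod N) = 0 → ((γ 0 1 : ℤ) : ZMod N) = 0 →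
      γ • u = u → (((γ 0 0 : ℤ) : ZMod N) = 1 ∨ ((γ 0 0 : ℤ) : ZMod N) = -1) := by
  obtain ⟨u, hu, h⟩ := exists_levelField_witness_row N hN
  refine ⟨u, hu, fun γ _ _ hγ ↦ ?_⟩
  rcases h γ hγ with ⟨h1, -⟩ | ⟨h1, -⟩
  · exact Or.inl h1
  · exact Or.inr h1

end UnboundedDenominators

end Literature.NumberTheory.Automorphic
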